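import Summits.BirchSwinnertonDyer.BirchSwinnertonDyer.Theorems.PrintCf2RubinValueTwoKatzMeasureJZeroTranslateTwelfth
import Summits.BirchSwinnertonDyer.BirchSwinnertonDyer.Theorems.PrintCf2RubinValueTwoKatzMeasureJZeroSupplyOfChainSeamRoot
import Literature.NumberTheory.EllipticCurves.DeShalit1987.RayClassTowerChain
import HarnessLib

set_option linter.dupNamespace false
set_option autoImplicit false

/-!
# `hseam♯` FROM THE PER-LEVEL CLASS-SUM IDENTITY — PART 2 (quantifier packaging) of the last (e)-assembly file `hseam♯_of_lane`

Cell `bsd-print-cf2`, width seat `bsd-line-cf2-p1-w3` g31 (the (e)-assembly packager); print leaf 24720 `KatzDistributionsAtTwoPrint`, R3 endpoint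
`KatzMeasureTwo.lMeasureJZero_classNumberOne_two` ⇐ `hsupply` (p764079) ⇐ prints + `hseam♯` (`supply_of_chainSeam_of_root`, p766233).
`--supports stmt-BirchSwinnertonDyer-24720` (helper, Theses-free).  THEOREMS ONLY (no `def`, no named fact, no `sorry`); CONDITIONAL on the
de Shalit II.2 prints `24(ii) 24(iii) 25(i) 27` (hypotheses) and on PART 1 (hypothesis `hP1`, the per-level identity, file
`…KatzMeasureJZeroSeamClassSumAtLevel`, -w8 g13); nothing is closed; no summit statement is proved by this seat; BSD is not proved by any of this.

THE CUT (STATUS 09:25Z).  PART 1 = for each principal-split `cm7` frame (the binders of `hseam♯` VERBATIM): `∃ Ω Ωp Θε τ, Ω ≠ 0 ∧ ‖Θε‖ ≤ 1 ∧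
∀ S ∌ v, v̄, ∀ chain (𝔣, 𝔩, 𝔪c, b) from 𝔤v̄² through S ∪ {v̄}, ∀ D2-outputs, ∀ μ` with D2's twisting relations, `∃ M₁, ∀ k w₁ λ M ≥ M₁` with
`𝔣 k = 𝔪_M`, hsum's per-instance hypotheses, `∀ I′` with `12·I′ = Θε·∫ ê d(δ_{τ,0}μ)`: hsum's `∃ T L` body with `I′` for the integral.
PART 2 (this file) = `hseam♯` from PART 1: per `S` the uniform round-robin chain (`DeShalit1987.exists_roundRobin_chain_uniform`), per `μ`
the translated twelfth `μ′ := δ_{τ,0}(Θε·μ/12)` (`exists_translate_twelfth_of_twoVariable_steps`: `‖μ′‖ ≤ 1`, `12·∫ ê dμ′ = Θε·∫ ê d(δ_{τ,0}μ)`),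
`M₁ := max M₁ 1`, and the level `k(M)` with `𝔣 k = 𝔪_M = (𝔤v̄)^{M+1}` (`modulusIdeal_insert_const_eq_pow`).

References: [deShalit1987] II.4.12 with Remarks (i)–(iv) (p. 66–69), II.4.14 (36)–(40) (p. 71–73), II.4.16 (49)–(50) (p. 76–77).
-/

noncomputable section

open scoped NumberField Classical nonZeroDivisors
open NumberField IsDedekindDomain Field
open IsDedekindDomain.HeightOneSpectrum ValuativeRel IsLocalRing
open Literature Literature.NumberTheory.GaloisRepresentations Literature.NumberTheory.EllipticCurves
open Literature.NumberTheory.GaloisRepresentations.IsNonarchimedeanLocalField Literature.NumberTheory.GaloisRepresentations.LubinTate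
  Literature.NumberTheory.GaloisRepresentations.ArtinLocalGlobal Literature.NumberTheory.PAdicHodge
open Literature.NumberTheory.LFunctions Literature.NumberTheory.NumberFields
open Literature.NumberTheory.EllipticCurves.GroupDistribution Literature.NumberTheory.ComplexMultiplication.EllipticUnits
open Literature.NumberTheory.LFunctions.AbelianDensity (artinSymbol)
open Literature.NumberTheory.EllipticCurves.DeShalit1987 Literature.NumberTheory.GaloisRepresentations.HeckeCharacter
open Summit.BirchSwinnertonDyer.BirchSwinnertonDyer.Theorems.PrintCf2.EllipticUnitsLocal
  Summit.BirchSwinnertonDyer.BirchSwinnertonDyer.Theorems.PrintCf2.EllipticUnitsGlobal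
  Summit.BirchSwinnertonDyer.BirchSwinnertonDyer.Theorems.PrintCf2.EllipticUnitsTwoVariable
open MvPowerSeries

namespace Summit.BirchSwinnertonDyer.BirchSwinnertonDyer.Theorems.PrintCf2.KatzMeasureJZeroTop

variable {K : Type} [Field K] [NumberField K] {v vbar : HeightOneSpectrum (𝓞 K)}

omit [NumberField K] in
/-- `𝔪_M = ∏_{w ∈ S ∪ {v̄}} w^{M+1} = (𝔤·v̄)^{M+1}` (`𝔤 = ∏_{w ∈ S} w`, `v̄ ∉ S`): the moduli of `hsum` are the uniform levels the
round-robin chain passes through (`DeShalit1987.exists_roundRobin_chain_uniform`). [cite: deShalit1987, II.4.12 (ii) (p. 67), II.4.16 (p. 76)] -/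
theorem modulusIdeal_insert_const_eq_pow (S : Finset (HeightOneSpectrum (𝓞 K))) (hvbarS : vbar ∉ S) (M : ℕ) :
    modulusIdeal (insert vbar S) (fun _ ↦ M) = ((∏ w ∈ S, w.asIdeal) * vbar.asIdeal) ^ (M + 1) := by
  unfold modulusIdeal
  rw [Finset.prod_insert hvbarS, Finset.prod_pow, mul_pow, mul_comm]

section Diagonal

attribute [local instance] ltNormUniformSpace ltNormIsUniformAddGroup rk1 nF nE fintypeResidueField
attribute [local instance] RelNormCoherentUnits.instCommMonoid GlobalNormCoherentUnits.instCommMonoid GlobalNormCoherentUnits.galAction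

set_option maxHeartbeats 1600000 in
/-- ★★ **`hseam♯` FROM THE PER-LEVEL CLASS-SUM IDENTITY (PART 2 of `hseam♯_of_lane`: the quantifier packaging).**  Given PART 1 — for each
principal-split `cm7` frame a period `Ω ≠ 0`, a unit `Ωp`, a root-number unit `Θε` (`‖Θε‖ ≤ 1`) and a reading conjugacy `τ ∈ Γ_K` such
that along ANY chain of moduli from `𝔤v̄²` through `S ∪ {v̄}` and for ANY measure `μ` with D2's twisting relations, at every level `k` with
`𝔣 k = 𝔪_M` the twisted class-sum identity holds for every `I′` with `12·I′ = Θε·∫ ê d(δ_{τ,0}μ)` — the seam hypothesis `hseam♯` of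
`supply_of_chainSeam_of_root` follows: per `S` take the uniform round-robin chain (`exists_roundRobin_chain_uniform`, passing through every
`𝔪_M = (𝔤v̄)^{M+1}`, `M ≥ 1`), per measure of record `μ` take `μ′ := δ_{τ,0}(Θε·μ/12)` (`exists_translate_twelfth_of_twoVariable_steps`:
`‖μ′‖ ≤ 1`, `12·∫ ê dμ′ = Θε·∫ ê d(δ_{τ,0}μ)`), `M₁ := max M₁ 1`, and read PART 1 at the level `k(M)`.
[cite: deShalit1987, II.4.12 (p. 66–69), II.4.14 (36)–(40) (p. 71–73), II.4.16 (49)–(50) (p. 76–77)] -/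
theorem chainSeam_of_root_of_perLevel
    (h24ii : DeShalit1987.prop24_ii_galoisAction) (h24iii : DeShalit1987.prop24_iii_unit) (h25 : DeShalit1987.prop25_i_normRelation)
    (h27 : DeShalit1987.prop27_power)
    (hP1 : ∀ (K : Type) [Field K] [NumberField K] [IsTotallyComplex K]
      (hK : IsImaginaryQuadratic K) (_ : NumberField.classNumber K = 1)
      (ι : PadicAlgCl 2 ≃+* ℂ) (w₀ : InfinitePlace K) (v vbar : HeightOneSpectrum (𝓞 K))
        (hv2 : ((2 : ℕ) : 𝓞 K) ∈ v.asIdeal) (hvbar2 : ((2 : ℕ) : 𝓞 K) ∈ vbar.asIdeal) (hne : vbar ≠ v)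
        (_ : ∀ (w : InfinitePlace K) (k : 𝓞 K), k ∈ v.asIdeal ↔ ‖ι.symm (w.embedding (k : K))‖ < 1)
        {α₀ : 𝓞 K} (hv0 : v.asIdeal = Ideal.span {α₀})
        (hdK : NumberField.discr K = -7) (hα₀ : α₀ ^ 2 - α₀ + 2 = 0)
        (hw2 : ∀ uu : (𝓞 K)ˣ, (uu : 𝓞 K) - 1 ∈ vbar.asIdeal ^ 2 → uu = 1)
    (hq : residueFieldCard (v.adicCompletion K) = 2)
    (h2 : (valuation (v.adicCompletion K)).IsUniformizer ((((2 : ℕ) : 𝒪[v.adicCompletion K]) : v.adicCompletion K)))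
    (u : 𝒪[v.adicCompletion K]ˣ)
    (hu : ((((u : 𝒪[v.adicCompletion K]) * ((2 : ℕ) : 𝒪[v.adicCompletion K]) : 𝒪[v.adicCompletion K]) : v.adicCompletion K)) = ((α₀ : K) : v.adicCompletion K))
    {σ₀ : absoluteGaloisGroup (v.adicCompletion K)} (hσ₀ : IsAbsArithFrob σ₀)
    {ε : (maxUnramifiedCompletion (v.adicCompletion K))ˣ}
    (hε : maxUnramifiedCompletion.galAut (v.adicCompletion K) σ₀ (ε : maxUnramifiedCompletion (v.adicCompletion K)) =
      algebraMap 𝒪[v.adicCompletion K] (maxUnramifiedCompletion (v.adicCompletion K)) (u : 𝒪[v.adicCompletion K]) * (ε : maxUnramifiedCompletion (v.adicCompletion K)))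
    (θ : CompletedAlgClosure (v.adicCompletion K) →+* ℂ_[2])
    (hθ1 : ∀ z : CBall (v.adicCompletion K), ‖θ (z : CompletedAlgClosure (v.adicCompletion K))‖ ≤ 1)
    (e₂ : v.adicCompletionIntegers K ≃+* ℤ_[2])
    (hΘe : ∀ a : 𝒪[v.adicCompletion K], (θ.comp ((CBall (v.adicCompletion K)).subtype.comp
        (algebraMap (UnrCoeff (v.adicCompletion K)) (CBall (v.adicCompletion K))))) (intToUnrCoeff (v.adicCompletion K) a) =
      padicIntCast ℂ_[2] (((e₂ : v.adicCompletionIntegers K →+* ℤ_[2]).comp (integerEquivAdicCompletionIntegers v).toRingHom) a))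
        (_ : Continuous θ)
        (_ : ∀ ζ' : ℂ_[2], (∃ n : ℕ, ζ' ^ 2 ^ n = 1) →
          ∃ ζ : CompletedAlgClosure (v.adicCompletion K), (∃ n : ℕ, ζ ^ 2 ^ n = 1) ∧ θ ζ = ζ')
        (_ : Function.Bijective θ) (_ : ∀ z : CompletedAlgClosure (v.adicCompletion K), ‖z‖ < 1 → ‖θ z‖ < 1),
      ∃ (Ω : ℂ) (Ωp : (unrIntegers 2)ˣ) (Θε : ℂ_[2]) (τ : absoluteGaloisGroup K), Ω ≠ 0 ∧ ‖Θε‖ ≤ 1 ∧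
      ∀ (S : Finset (HeightOneSpectrum (𝓞 K))), v ∉ S → vbar ∉ S →
      ∀ (𝔣 : ℕ → Ideal (𝓞 K)) (𝔩 : ℕ → HeightOneSpectrum (𝓞 K)) (𝔪c : ℕ → Ideal (𝓞 K)) (b : ℕ → ℕ)
        (_ : 𝔣 0 = (∏ w ∈ S, w.asIdeal) * vbar.asIdeal ^ 2)
        (h𝔣succ : ∀ k, 𝔣 (k + 1) = 𝔣 k * (𝔩 k).asIdeal) (hdiv : ∀ k, (𝔩 k).asIdeal ∣ 𝔣 k)
        (_ : ∀ k, 𝔣 k = 𝔪c k * vbar.asIdeal ^ (b k + 1)) (_ : ∀ k, 1 ≤ b k)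
        (_ : ∀ k, ¬ 𝔪c k ≤ v.asIdeal) (_ : ∀ k, ¬ 𝔪c k ≤ vbar.asIdeal)
        (_ : ∀ k, 𝔩 k = vbar ∨ 𝔩 k ∈ S)
        (_ : ∀ m : ℕ, ∃ n, 𝔣 n ≤ ((∏ w ∈ S, w.asIdeal) * vbar.asIdeal) ^ m)
    (h𝔣0 : ∀ m : ℕ, 𝔣 m ≠ ⊥) (h𝔣1 : ∀ m : ℕ, 𝔣 m ≠ ⊤)
      (hvm : ∀ m : ℕ, ¬ 𝔣 m ≤ v.asIdeal)
      (hwm : ∀ (m : ℕ) (u : (𝓞 K)ˣ), (u : 𝓞 K) - 1 ∈ 𝔣 m → u = 1)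
      (hle : ∀ m : ℕ, 𝔣 (m + 1) ≤ 𝔣 m)
      (α : ℕ → 𝓞 K) (hα0 : ∀ m, α m ≠ 0) (hα𝔣 : ∀ m, α m - 1 ∈ 𝔣 m)
      (hαw : ∀ (m : ℕ) (w : HeightOneSpectrum (𝓞 K)), w ≠ v → α m ∉ w.asIdeal)
      (f : ℕ → ℕ) (hαπ : ∀ m, ((α m : K) : v.adicCompletion K) =
        ((((u : 𝒪[v.adicCompletion K]) * ((2 : ℕ) : 𝒪[v.adicCompletion K]) : 𝒪[v.adicCompletion K]) : v.adicCompletion K)) ^ f m)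
      (E : ℕ → IntermediateField (v.adicCompletion K) (AlgebraicClosure (v.adicCompletion K)))
      (_ : ∀ m, FiniteDimensional (v.adicCompletion K) (E m)) (_ : ∀ m, IsGalois (v.adicCompletion K) (E m))
      (hE : ∀ m, E m ≤ maxUnramified (v.adicCompletion K))
      (hdegE : ∀ (m : ℕ) (w : WeilGroup (v.adicCompletion K)),
        WeilGroup.toAbsGalois (v.adicCompletion K) w ∈ (E m).fixingSubgroup → (f m : ℤ) ∣ WeilGroup.deg w)
      (hEE : ∀ m, E m ≤ E (m + 1))
      (j : ∀ m : ℕ, unitBall (E m) →+* UnrCoeff (v.adicCompletion K))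
      (_ : ∀ m, (j m).comp (algebraMap (LTCoeff (v.adicCompletion K)) (unitBall (E m))) =
        (intToUnrCoeff (v.adicCompletion K)).comp (LTCoeff.of (v.adicCompletion K)).symm.toRingHom)
      (hjC : ∀ m, (algebraMap (UnrCoeff (v.adicCompletion K)) (CBall (v.adicCompletion K))).comp (j m) = unitBallToCBall (E m))
      (_ : ∀ (m : ℕ) (y : unitBall (E m)), j (m + 1) (inclUnitBall (F := v.adicCompletion K) (hEE m) y) = j m y)
      (ψ : ∀ m n : ℕ, ↥(absRestrictNormalHom (rayClassField K (𝔣 m))).ker ⧸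
        (rayAdicTower (𝔪 := 𝔣 m) (h𝔣0 m) v).U n → ZMod (2 ^ (n + 1)))
      (hψ : ∀ (m n : ℕ) (g : ↥(absRestrictNormalHom (rayClassField K (𝔣 m))).ker),
        g ∈ (rayAdicTower (𝔪 := 𝔣 m) (h𝔣0 m) v).U 0 →
        ψ m n ((rayAdicTower (𝔪 := 𝔣 m) (h𝔣0 m) v).proj n g) =
          PadicInt.toZModPow (n + 1) ((((Units.map (e₂ : v.adicCompletionIntegers K →+* ℤ_[2]).toMonoidHom).comp
            (rayAdicCharacter (h𝔣0 m) (hvm m) (hwm m)))⁻¹ g : ℤ_[2]ˣ) : ℤ_[2]))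
      (g : {c : Ideal (𝓞 K) // c ≠ ⊥ ∧ IsCoprime c (𝔣 0 * v.asIdeal)} → absoluteGaloisGroup K)
      (_ : ∀ (c : {c : Ideal (𝓞 K) // c ≠ ⊥ ∧ IsCoprime c (𝔣 0 * v.asIdeal)}) (m k : ℕ),
        absRestrictNormalHom (rayClassField K (𝔣 m * v.asIdeal ^ (k + 1))) (g c) =
          artinSymbol (galFrob K (rayClassField K (𝔣 m * v.asIdeal ^ (k + 1)))) c.1)
      (x : ∀ (_ : {c : Ideal (𝓞 K) // c ≠ ⊥ ∧ IsCoprime c (𝔣 0 * v.asIdeal)}) (m k : ℕ),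
        rayClassField K (𝔣 m * v.asIdeal ^ (k + 1)))
      (hx : ∀ (c : {c : Ideal (𝓞 K) // c ≠ ⊥ ∧ IsCoprime c (𝔣 0 * v.asIdeal)}) (m k : ℕ),
        IsThetaValueOne w₀.embedding (𝔣 m * v.asIdeal ^ (k + 1)) c.1
          (algClosureEmb w₀.embedding ((x c m k : rayClassField K (𝔣 m * v.asIdeal ^ (k + 1))) : AlgebraicClosure K)))
      (_ : ∀ m n, ((rayAdicTower (𝔪 := 𝔣 m) (h𝔣0 m) v).U n).Normal)
      (_ : ∀ m n, ((absRayAdicTower (𝔪' := 𝔣 m) (h𝔣0 m) v).U n).Normal)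
      (μ : GroupDistribution (SubgroupTower.diagonal (fun m ↦ absRayAdicTower (𝔪' := 𝔣 m) (h𝔣0 m) v)
        (fun m n ↦ absRayAdicTower_U_anti (h𝔣0 m) (h𝔣0 (m + 1)) v (hle m) n)) ℂ_[2]),
      μ.bound = 1 →
      (∀ (c : {c : Ideal (𝓞 K) // c ≠ ⊥ ∧ IsCoprime c (𝔣 0 * v.asIdeal)}) (n : ℕ)
        (b : absoluteGaloisGroup K ⧸ (absRayAdicTower (𝔪' := 𝔣 n) (h𝔣0 n) v).U n),
        (twisting (g c) (Ideal.absNorm c.1 : ℂ_[2]) μ).μ n b =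
        (GroupDistribution.induceFrom (Γ := absoluteGaloisGroup K)
          (fun k ↦ rayAdicTower_U_eq_subgroupOf (𝔪 := 𝔣 n) (h𝔣0 n) v k)
          (fun b : GlobalNormCoherentUnits (h𝔣0 n) v ↦
            localMeasureFamily (h𝔣0 n) (hvm n) (hwm n) hq h2 u (E n) (hE n) hσ₀ hε θ hθ1 (j n) (hjC n) e₂ (ψ n) (hψ n)
              (RelNormCoherentUnits.ofGlobalUnits (h𝔣0 n) (hvm n) (hwm n) (isUniformizer_unit_mul h2 u) (hα0 n) (hα𝔣 n) (hαw n)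
                (hαπ n) (E n) (hE n) (hdegE n) b))
          zero_le_one (fun _ ↦ le_rfl)
          (ellipticUnitsGlobal h24iii h25 hK w₀.embedding (h𝔣0 n) (h𝔣1 n) (hvm n) (hwm n) c.2.1 (isCoprime_chain 𝔣 𝔩 h𝔣succ hdiv c.2.2 n)
            (x c n) (hx c n))).μ n b) →
      ∃ M₁ : ℕ, ∀ (k : ℕ) (w₁ : InfinitePlace K) (lam : HeckeCharacter K) (M : ℕ), M₁ ≤ M →
          𝔣 k = modulusIdeal (insert vbar S) (fun _ ↦ M) →
          lam.HasInfinityType (fun _ ↦ 1) (fun _ ↦ 0) →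
          lam.IsModulus (insert vbar S) (fun _ ↦ M) →
          modulusIdeal (insert vbar S) (fun _ ↦ M) ≠ ⊤ →
          (∀ uu : (𝓞 K)ˣ, (uu : 𝓞 K) - 1 ∈ modulusIdeal (insert vbar S) (fun _ ↦ M) → uu = 1) →
          ∀ (χ : HeightOneSpectrum (𝓞 K) → ℂ), IsRayClassCharacter (modulusIdeal (insert vbar S) (fun _ ↦ M)) χ →
          ∀ (𝔠 : Ideal (𝓞 K)), 𝔠 ≠ ⊥ → IsCoprime 𝔠 (modulusIdeal (insert vbar S) (fun _ ↦ M)) →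
            IsCoprime 𝔠 v.asIdeal →
          ∀ (εH : HeckeCharacter K) (eH : FramedGaloisRep K (PadicAlgCl 2) 1) (m : ℕ),
            IsPAdicAvatarOutside S ι εH eH → 3 ≤ m →
            εH.HasInfinityType (fun _ ↦ -(m : ℤ)) (fun _ ↦ 0) →
            (∀ w : HeightOneSpectrum (𝓞 K), w ∉ S → w ≠ vbar → εH.IsUnramifiedAt w) →
            (SubgroupTower.diagonal (fun m ↦ absRayAdicTower (𝔪' := 𝔣 m) (h𝔣0 m) v)
                (fun m n ↦ absRayAdicTower_U_anti (h𝔣0 m) (h𝔣0 (m + 1)) v (hle m) n)).IsTowerContinuous (fun σ ↦ avatarValueAt eH σ) →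
            (∀ w : HeightOneSpectrum (𝓞 K), ¬ modulusIdeal (insert vbar S) (fun _ ↦ M) ≤ w.asIdeal →
              εH.valueAtUniformizer w = (χ w)⁻¹ * (lam.valueAtUniformizer w ^ m)⁻¹) →
            ∀ hL : LFunction.HasEntireContinuation (heckeLFunction εH),
            ∀ I' : ℂ_[2], (12 : ℂ_[2]) * I' = Θε * (twisting τ 0 μ).integral (fun σ ↦ avatarValueAt eH σ) →
            ∃ (T : Finset (Ideal (𝓞 K))) (L : Ideal (𝓞 K) → PeriodPair),
              IsRayClassReps (modulusIdeal (insert vbar S) (fun _ ↦ M)) T ∧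
              (∀ 𝔟 ∈ T, ∀ z : ℂ, z ∈ (L 𝔟).lattice ↔
                ∃ x ∈ ((modulusIdeal (insert vbar S) (fun _ ↦ M) : FractionalIdeal (𝓞 K)⁰ K) /
                  (𝔟 : FractionalIdeal (𝓞 K)⁰ K)), z = Ω * w₁.embedding x) ∧
              (∀ 𝔟 ∈ T, ∀ z : ℂ, z ∈ (L (𝔠 * 𝔟)).lattice ↔
                ∃ x ∈ ((modulusIdeal (insert vbar S) (fun _ ↦ M) : FractionalIdeal (𝓞 K)⁰ K) /
                  ((𝔠 * 𝔟 : Ideal (𝓞 K)) : FractionalIdeal (𝓞 K)⁰ K)), z = Ω * w₁.embedding x) ∧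
              ((Ideal.absNorm 𝔠 : ℂ_[2]) -
                  ((ι.symm (idealPow K χ 𝔠 * idealPow K (fun w ↦ lam.valueAtUniformizer w) 𝔠 ^ m) : PadicAlgCl 2) :
                    ℂ_[2])) * I' =
                ((ι.symm ((1 - (εH.valueAtUniformizer v)⁻¹ * (((2 : ℕ) : ℂ))⁻¹) *
                    ∑ 𝔟 ∈ T, (idealPow K χ 𝔟)⁻¹ * (idealPow K (fun w ↦ lam.valueAtUniformizer w) 𝔟 ^ m)⁻¹ *
                      ((Ideal.absNorm 𝔠 : ℂ) * (L 𝔟).eisensteinE m Ω - (L (𝔠 * 𝔟)).eisensteinE m Ω)) : PadicAlgCl 2) :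
                  ℂ_[2]) * ((Ωp : unrIntegers 2) : ℂ_[2]) ^ m) :
    ∀ (K : Type) [Field K] [NumberField K] [IsTotallyComplex K]
      (hK : IsImaginaryQuadratic K) (_ : NumberField.classNumber K = 1)
      (ι : PadicAlgCl 2 ≃+* ℂ) (w₀ : InfinitePlace K) (v vbar : HeightOneSpectrum (𝓞 K))
        (hv2 : ((2 : ℕ) : 𝓞 K) ∈ v.asIdeal) (hvbar2 : ((2 : ℕ) : 𝓞 K) ∈ vbar.asIdeal) (hne : vbar ≠ v)
        (_ : ∀ (w : InfinitePlace K) (k : 𝓞 K), k ∈ v.asIdeal ↔ ‖ι.symm (w.embedding (k : K))‖ < 1)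
        {α₀ : 𝓞 K} (hv0 : v.asIdeal = Ideal.span {α₀})
        (hdK : NumberField.discr K = -7) (hα₀ : α₀ ^ 2 - α₀ + 2 = 0)
        (hw2 : ∀ uu : (𝓞 K)ˣ, (uu : 𝓞 K) - 1 ∈ vbar.asIdeal ^ 2 → uu = 1)
    (hq : residueFieldCard (v.adicCompletion K) = 2)
    (h2 : (valuation (v.adicCompletion K)).IsUniformizer ((((2 : ℕ) : 𝒪[v.adicCompletion K]) : v.adicCompletion K)))
    (u : 𝒪[v.adicCompletion K]ˣ)
    (hu : ((((u : 𝒪[v.adicCompletion K]) * ((2 : ℕ) : 𝒪[v.adicCompletion K]) : 𝒪[v.adicCompletion K]) : v.adicCompletion K)) = ((α₀ : K) : v.adicCompletion K))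
    {σ₀ : absoluteGaloisGroup (v.adicCompletion K)} (hσ₀ : IsAbsArithFrob σ₀)
    {ε : (maxUnramifiedCompletion (v.adicCompletion K))ˣ}
    (hε : maxUnramifiedCompletion.galAut (v.adicCompletion K) σ₀ (ε : maxUnramifiedCompletion (v.adicCompletion K)) =
      algebraMap 𝒪[v.adicCompletion K] (maxUnramifiedCompletion (v.adicCompletion K)) (u : 𝒪[v.adicCompletion K]) * (ε : maxUnramifiedCompletion (v.adicCompletion K)))
    (θ : CompletedAlgClosure (v.adicCompletion K) →+* ℂ_[2])
    (hθ1 : ∀ z : CBall (v.adicCompletion K), ‖θ (z : CompletedAlgClosure (v.adicCompletion K))‖ ≤ 1)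
    (e₂ : v.adicCompletionIntegers K ≃+* ℤ_[2])
    (hΘe : ∀ a : 𝒪[v.adicCompletion K], (θ.comp ((CBall (v.adicCompletion K)).subtype.comp
        (algebraMap (UnrCoeff (v.adicCompletion K)) (CBall (v.adicCompletion K))))) (intToUnrCoeff (v.adicCompletion K) a) =
      padicIntCast ℂ_[2] (((e₂ : v.adicCompletionIntegers K →+* ℤ_[2]).comp (integerEquivAdicCompletionIntegers v).toRingHom) a))
        (_ : Continuous θ)
        (_ : ∀ ζ' : ℂ_[2], (∃ n : ℕ, ζ' ^ 2 ^ n = 1) →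
          ∃ ζ : CompletedAlgClosure (v.adicCompletion K), (∃ n : ℕ, ζ ^ 2 ^ n = 1) ∧ θ ζ = ζ')
        (_ : Function.Bijective θ) (_ : ∀ z : CompletedAlgClosure (v.adicCompletion K), ‖z‖ < 1 → ‖θ z‖ < 1),
      ∃ (Ω : ℂ) (Ωp : (unrIntegers 2)ˣ), Ω ≠ 0 ∧
      ∀ (S : Finset (HeightOneSpectrum (𝓞 K))), v ∉ S → vbar ∉ S →
      ∃ (𝔣 : ℕ → Ideal (𝓞 K)) (𝔩 : ℕ → HeightOneSpectrum (𝓞 K)) (𝔪c : ℕ → Ideal (𝓞 K)) (b : ℕ → ℕ)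
        (h𝔣succ : ∀ k, 𝔣 (k + 1) = 𝔣 k * (𝔩 k).asIdeal) (hdiv : ∀ k, (𝔩 k).asIdeal ∣ 𝔣 k)
        (_ : ∀ k, 𝔣 k = 𝔪c k * vbar.asIdeal ^ (b k + 1)) (_ : ∀ k, 1 ≤ b k)
        (_ : ∀ k, ¬ 𝔪c k ≤ v.asIdeal) (_ : ∀ k, ¬ 𝔪c k ≤ vbar.asIdeal)
        (_ : ∀ m : ℕ, ∃ n, 𝔣 n ≤ ((∏ w ∈ S, w.asIdeal) * vbar.asIdeal) ^ m),
    ∀ (h𝔣0 : ∀ m : ℕ, 𝔣 m ≠ ⊥) (h𝔣1 : ∀ m : ℕ, 𝔣 m ≠ ⊤)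
      (hvm : ∀ m : ℕ, ¬ 𝔣 m ≤ v.asIdeal)
      (hwm : ∀ (m : ℕ) (u : (𝓞 K)ˣ), (u : 𝓞 K) - 1 ∈ 𝔣 m → u = 1)
      (hle : ∀ m : ℕ, 𝔣 (m + 1) ≤ 𝔣 m)
      (α : ℕ → 𝓞 K) (hα0 : ∀ m, α m ≠ 0) (hα𝔣 : ∀ m, α m - 1 ∈ 𝔣 m)
      (hαw : ∀ (m : ℕ) (w : HeightOneSpectrum (𝓞 K)), w ≠ v → α m ∉ w.asIdeal)
      (f : ℕ → ℕ) (hαπ : ∀ m, ((α m : K) : v.adicCompletion K) =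
        ((((u : 𝒪[v.adicCompletion K]) * ((2 : ℕ) : 𝒪[v.adicCompletion K]) : 𝒪[v.adicCompletion K]) : v.adicCompletion K)) ^ f m)
      (E : ℕ → IntermediateField (v.adicCompletion K) (AlgebraicClosure (v.adicCompletion K)))
      (_ : ∀ m, FiniteDimensional (v.adicCompletion K) (E m)) (_ : ∀ m, IsGalois (v.adicCompletion K) (E m))
      (hE : ∀ m, E m ≤ maxUnramified (v.adicCompletion K))
      (hdegE : ∀ (m : ℕ) (w : WeilGroup (v.adicCompletion K)),
        WeilGroup.toAbsGalois (v.adicCompletion K) w ∈ (E m).fixingSubgroup → (f m : ℤ) ∣ WeilGroup.deg w)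
      (hEE : ∀ m, E m ≤ E (m + 1))
      (j : ∀ m : ℕ, unitBall (E m) →+* UnrCoeff (v.adicCompletion K))
      (_ : ∀ m, (j m).comp (algebraMap (LTCoeff (v.adicCompletion K)) (unitBall (E m))) =
        (intToUnrCoeff (v.adicCompletion K)).comp (LTCoeff.of (v.adicCompletion K)).symm.toRingHom)
      (hjC : ∀ m, (algebraMap (UnrCoeff (v.adicCompletion K)) (CBall (v.adicCompletion K))).comp (j m) = unitBallToCBall (E m))
      (_ : ∀ (m : ℕ) (y : unitBall (E m)), j (m + 1) (inclUnitBall (F := v.adicCompletion K) (hEE m) y) = j m y)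
      (ψ : ∀ m n : ℕ, ↥(absRestrictNormalHom (rayClassField K (𝔣 m))).ker ⧸
        (rayAdicTower (𝔪 := 𝔣 m) (h𝔣0 m) v).U n → ZMod (2 ^ (n + 1)))
      (hψ : ∀ (m n : ℕ) (g : ↥(absRestrictNormalHom (rayClassField K (𝔣 m))).ker),
        g ∈ (rayAdicTower (𝔪 := 𝔣 m) (h𝔣0 m) v).U 0 →
        ψ m n ((rayAdicTower (𝔪 := 𝔣 m) (h𝔣0 m) v).proj n g) =
          PadicInt.toZModPow (n + 1) ((((Units.map (e₂ : v.adicCompletionIntegers K →+* ℤ_[2]).toMonoidHom).comp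
            (rayAdicCharacter (h𝔣0 m) (hvm m) (hwm m)))⁻¹ g : ℤ_[2]ˣ) : ℤ_[2]))
      (g : {c : Ideal (𝓞 K) // c ≠ ⊥ ∧ IsCoprime c (𝔣 0 * v.asIdeal)} → absoluteGaloisGroup K)
      (_ : ∀ (c : {c : Ideal (𝓞 K) // c ≠ ⊥ ∧ IsCoprime c (𝔣 0 * v.asIdeal)}) (m k : ℕ),
        absRestrictNormalHom (rayClassField K (𝔣 m * v.asIdeal ^ (k + 1))) (g c) =
          artinSymbol (galFrob K (rayClassField K (𝔣 m * v.asIdeal ^ (k + 1)))) c.1)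
      (x : ∀ (_ : {c : Ideal (𝓞 K) // c ≠ ⊥ ∧ IsCoprime c (𝔣 0 * v.asIdeal)}) (m k : ℕ),
        rayClassField K (𝔣 m * v.asIdeal ^ (k + 1)))
      (hx : ∀ (c : {c : Ideal (𝓞 K) // c ≠ ⊥ ∧ IsCoprime c (𝔣 0 * v.asIdeal)}) (m k : ℕ),
        IsThetaValueOne w₀.embedding (𝔣 m * v.asIdeal ^ (k + 1)) c.1
          (algClosureEmb w₀.embedding ((x c m k : rayClassField K (𝔣 m * v.asIdeal ^ (k + 1))) : AlgebraicClosure K)))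
      (_ : ∀ m n, ((rayAdicTower (𝔪 := 𝔣 m) (h𝔣0 m) v).U n).Normal)
      (_ : ∀ m n, ((absRayAdicTower (𝔪' := 𝔣 m) (h𝔣0 m) v).U n).Normal)
      (μ : GroupDistribution (SubgroupTower.diagonal (fun m ↦ absRayAdicTower (𝔪' := 𝔣 m) (h𝔣0 m) v)
        (fun m n ↦ absRayAdicTower_U_anti (h𝔣0 m) (h𝔣0 (m + 1)) v (hle m) n)) ℂ_[2]),
      μ.bound = 1 →
      (∀ (c : {c : Ideal (𝓞 K) // c ≠ ⊥ ∧ IsCoprime c (𝔣 0 * v.asIdeal)}) (n : ℕ)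
        (b : absoluteGaloisGroup K ⧸ (absRayAdicTower (𝔪' := 𝔣 n) (h𝔣0 n) v).U n),
        (twisting (g c) (Ideal.absNorm c.1 : ℂ_[2]) μ).μ n b =
        (GroupDistribution.induceFrom (Γ := absoluteGaloisGroup K)
          (fun k ↦ rayAdicTower_U_eq_subgroupOf (𝔪 := 𝔣 n) (h𝔣0 n) v k)
          (fun b : GlobalNormCoherentUnits (h𝔣0 n) v ↦
            localMeasureFamily (h𝔣0 n) (hvm n) (hwm n) hq h2 u (E n) (hE n) hσ₀ hε θ hθ1 (j n) (hjC n) e₂ (ψ n) (hψ n)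
              (RelNormCoherentUnits.ofGlobalUnits (h𝔣0 n) (hvm n) (hwm n) (isUniformizer_unit_mul h2 u) (hα0 n) (hα𝔣 n) (hαw n)
                (hαπ n) (E n) (hE n) (hdegE n) b))
          zero_le_one (fun _ ↦ le_rfl)
          (ellipticUnitsGlobal h24iii h25 hK w₀.embedding (h𝔣0 n) (h𝔣1 n) (hvm n) (hwm n) c.2.1 (isCoprime_chain 𝔣 𝔩 h𝔣succ hdiv c.2.2 n)
            (x c n) (hx c n))).μ n b) →
      ∃ μ' : GroupDistribution (SubgroupTower.diagonal (fun m ↦ absRayAdicTower (𝔪' := 𝔣 m) (h𝔣0 m) v)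
        (fun m n ↦ absRayAdicTower_U_anti (h𝔣0 m) (h𝔣0 (m + 1)) v (hle m) n)) ℂ_[2],
        μ'.bound ≤ 1 ∧
        ∃ M₁ : ℕ, ∀ (w₁ : InfinitePlace K) (lam : HeckeCharacter K) (M : ℕ), M₁ ≤ M →
          lam.HasInfinityType (fun _ ↦ 1) (fun _ ↦ 0) →
          lam.IsModulus (insert vbar S) (fun _ ↦ M) →
          modulusIdeal (insert vbar S) (fun _ ↦ M) ≠ ⊤ →
          (∀ uu : (𝓞 K)ˣ, (uu : 𝓞 K) - 1 ∈ modulusIdeal (insert vbar S) (fun _ ↦ M) → uu = 1) →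
          ∀ (χ : HeightOneSpectrum (𝓞 K) → ℂ), IsRayClassCharacter (modulusIdeal (insert vbar S) (fun _ ↦ M)) χ →
          ∀ (𝔠 : Ideal (𝓞 K)), 𝔠 ≠ ⊥ → IsCoprime 𝔠 (modulusIdeal (insert vbar S) (fun _ ↦ M)) →
            IsCoprime 𝔠 v.asIdeal →
          ∀ (εH : HeckeCharacter K) (eH : FramedGaloisRep K (PadicAlgCl 2) 1) (m : ℕ),
            IsPAdicAvatarOutside S ι εH eH → 3 ≤ m →
            εH.HasInfinityType (fun _ ↦ -(m : ℤ)) (fun _ ↦ 0) →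
            (∀ w : HeightOneSpectrum (𝓞 K), w ∉ S → w ≠ vbar → εH.IsUnramifiedAt w) →
            (SubgroupTower.diagonal (fun m ↦ absRayAdicTower (𝔪' := 𝔣 m) (h𝔣0 m) v)
                (fun m n ↦ absRayAdicTower_U_anti (h𝔣0 m) (h𝔣0 (m + 1)) v (hle m) n)).IsTowerContinuous (fun σ ↦ avatarValueAt eH σ) →
            (∀ w : HeightOneSpectrum (𝓞 K), ¬ modulusIdeal (insert vbar S) (fun _ ↦ M) ≤ w.asIdeal →
              εH.valueAtUniformizer w = (χ w)⁻¹ * (lam.valueAtUniformizer w ^ m)⁻¹) →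
            ∀ hL : LFunction.HasEntireContinuation (heckeLFunction εH),
            ∃ (T : Finset (Ideal (𝓞 K))) (L : Ideal (𝓞 K) → PeriodPair),
              IsRayClassReps (modulusIdeal (insert vbar S) (fun _ ↦ M)) T ∧
              (∀ 𝔟 ∈ T, ∀ z : ℂ, z ∈ (L 𝔟).lattice ↔
                ∃ x ∈ ((modulusIdeal (insert vbar S) (fun _ ↦ M) : FractionalIdeal (𝓞 K)⁰ K) /
                  (𝔟 : FractionalIdeal (𝓞 K)⁰ K)), z = Ω * w₁.embedding x) ∧
              (∀ 𝔟 ∈ T, ∀ z : ℂ, z ∈ (L (𝔠 * 𝔟)).lattice ↔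
                ∃ x ∈ ((modulusIdeal (insert vbar S) (fun _ ↦ M) : FractionalIdeal (𝓞 K)⁰ K) /
                  ((𝔠 * 𝔟 : Ideal (𝓞 K)) : FractionalIdeal (𝓞 K)⁰ K)), z = Ω * w₁.embedding x) ∧
              ((Ideal.absNorm 𝔠 : ℂ_[2]) -
                  ((ι.symm (idealPow K χ 𝔠 * idealPow K (fun w ↦ lam.valueAtUniformizer w) 𝔠 ^ m) : PadicAlgCl 2) :
                    ℂ_[2])) * μ'.integral (fun σ ↦ avatarValueAt eH σ) =
                ((ι.symm ((1 - (εH.valueAtUniformizer v)⁻¹ * (((2 : ℕ) : ℂ))⁻¹) *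
                    ∑ 𝔟 ∈ T, (idealPow K χ 𝔟)⁻¹ * (idealPow K (fun w ↦ lam.valueAtUniformizer w) 𝔟 ^ m)⁻¹ *
                      ((Ideal.absNorm 𝔠 : ℂ) * (L 𝔟).eisensteinE m Ω - (L (𝔠 * 𝔟)).eisensteinE m Ω)) : PadicAlgCl 2) :
                  ℂ_[2]) * ((Ωp : unrIntegers 2) : ℂ_[2]) ^ m := by
  intro K _ _ _ hK hh ι w₀ v vbar hv2 hvbar2 hne hι α₀ hv0 hdK hα₀ hw2 hq h2 u hu σ₀ hσ₀ ε hε θ hθ1 e₂ hΘe hθc hθζ hθb hθlt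
  obtain ⟨Ω, Ωp, Θε, τ, hΩ, hΘε, hmain⟩ := hP1 K hK hh ι w₀ v vbar hv2 hvbar2 hne hι hv0 hdK hα₀ hw2 hq h2 u hu hσ₀ hε θ hθ1
    e₂ hΘe hθc hθζ hθb hθlt
  refine ⟨Ω, Ωp, hΩ, fun S hvS hvbarS ↦ ?_⟩
  obtain ⟨𝔣, 𝔩, 𝔪c, b, h𝔣start, h𝔣succ, hdiv, h𝔣eq, hb, h𝔪v, h𝔪vbar, -, -, h𝔩S, -, hcof, -, hlev⟩ :=
    exists_roundRobin_chain_uniform S hvS hvbarS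
  refine ⟨𝔣, 𝔩, 𝔪c, b, h𝔣succ, hdiv, h𝔣eq, hb, h𝔪v, h𝔪vbar, hcof, ?_⟩
  intro h𝔣0 h𝔣1 hvm hwm hle α hα0 hα𝔣 hαw f hαπ E hfd hgal hE hdegE hEE j hj hjC hjj ψ hψ g hg x hx hN hNabs μ hbd hμ
  obtain ⟨M₁, hM⟩ := hmain S hvS hvbarS 𝔣 𝔩 𝔪c b h𝔣start h𝔣succ hdiv h𝔣eq hb h𝔪v h𝔪vbar h𝔩S hcof h𝔣0 h𝔣1 hvm hwm hle α
    hα0 hα𝔣 hαw f hαπ E hfd hgal hE hdegE hEE j hj hjC hjj ψ hψ g hg x hx hN hNabs μ hbd hμ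
  obtain ⟨μ'', hb'', hint⟩ := exists_translate_twelfth_of_twoVariable_steps h24ii h24iii h25 h27 hK w₀.embedding 𝔣 𝔩 h𝔣succ
    hdiv 𝔪c b h𝔣eq h𝔪v h𝔪vbar hw2 hv2 hvbar2 hne hq h2 u hσ₀ hε θ hθ1 e₂ hΘe h𝔣0 h𝔣1 hvm hwm hle α hα0 hα𝔣 hαw f hαπ E hfd
    hgal hE hdegE j hj hjC ψ hψ g hg x hx hN hNabs μ hμ Θε hΘε τ
  refine ⟨μ'', hb'', max M₁ 1, fun w₁ lam M hM₁ hl hlmod h𝔪1 hwM χ hχ 𝔠 h𝔠0 h𝔠cop h𝔠v εH eH m he hm hεH hεu hcont hval hL ↦ ?_⟩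
  have hM1 : 1 ≤ M := le_of_max_le_right hM₁
  obtain ⟨k, hk⟩ := hlev (M - 1)
  have hk' : 𝔣 k = modulusIdeal (insert vbar S) (fun _ ↦ M) := by
    rw [hk, modulusIdeal_insert_const_eq_pow S hvbarS M, show M - 1 + 2 = M + 1 by omega]
  exact hM k w₁ lam M (le_of_max_le_left hM₁) hk' hl hlmod h𝔪1 hwM χ hχ 𝔠 h𝔠0 h𝔠cop h𝔠v εH eH m he hm hεH hεu hcont hval hL
    _ (hint eH hcont).1

end Diagonal

end Summit.BirchSwinnertonDyer.BirchSwinnertonDyer.Theorems.PrintCf2.KatzMeasureJZeroTop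

end
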